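import Mathlib.Analysis.MellinTransform
import Mathlib.Analysis.SpecialFunctions.Gaussian.GaussianIntegral
import Mathlib.Analysis.SpecialFunctions.Gamma.Deligne
import Mathlib.NumberTheory.LSeries.RiemannZeta
import Literature.NumberTheory.LFunctions.RiemannXi
import HarnessLib

/-!
# Riemann's `ξ` as `4 ζ(w) · 𝓜h(w)` for `h(x) = (π²x⁴ − (3/2)πx²) e^{−πx²}`

Connes–Consani–Moscovici 2025, (7.1) and Lemma 7.1 (= Connes 2026, Letter, Fact 6.2): Riemann's `Ξ`
is the Fourier transform, for the duality `⟨ℝ*₊ | ℝ⟩`, of `k = 𝓔(h)` with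
`h(u) = (π/2) u² (2πu² − 3) e^{−πu²} = (π²u⁴ − (3/2)πu²) e^{−πu²}`, the combination
`(√3/2^{11/4}) h_4 − (3/2^{17/4}) h_0` of the normalised Hermite functions with vanishing integral.
In Mellin language (with Müntz's formula `𝓜[𝓔f](s) = ζ(½+s) 𝓜f(s+½)`, file `MuentzFormula.lean`)
the content of the lemma is the classical Gamma-integral computation recorded here, sorry-free:

* `mellin_exp_neg_pi_mul_sq` — `∫_0^∞ x^{v-1} e^{−πx²} dx = Γ_ℝ(v)/2 = π^{−v/2} Γ(v/2)/2` (`Re v > 0`),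
  with absolute convergence (`mellinConvergent_exp_neg_pi_mul_sq`), and the shifted versions
  `mellin_pow_mul_exp_neg_pi_mul_sq` for `x^n e^{−πx²}`;
* `mellin_connesHermiteH` — `𝓜h(w) = Γ_ℝ(w) · w(w−1)/8` (`Re w > 0`), via `Γ_ℝ(s+2) = Γ_ℝ(s)·s/(2π)`;
* `riemannXi_eq_four_mul_zeta_mul_mellin` — **`ξ(w) = 4 ζ(w) 𝓜h(w)`** for `Re w > 0`, `w ≠ 1`
  (the tree's `riemannXi w = w(w−1)/2 · Λ(w)` and Mathlib's `ζ = Λ/Γ_ℝ`); at `w = 1` the two sides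
  differ because `𝓜h(1) = 0` while `ξ(1) = ½` (pole of `ζ`).

This is the `ξ`-side of the identity `4M_λ(s) − ξ(½+s) = 4ζ(½+s)(𝓜h_λ − 𝓜h)(s+½) − 4B_λ(s)` used
in analyses of the Letter's Fact 6.4 (the `M_λ`-side is `ConnesProlateGuessTail.lean`); nothing here
depends on prolate functions.
-/

open Real Complex Set MeasureTheory

namespace Literature.NumberTheory.LFunctions

/-- Riemann's / Connes' test function `h(x) = (π²x⁴ − (3/2)πx²) e^{−πx²} = (π/2)x²(2πx² − 3)e^{−πx²}`
(Connes–Consani–Moscovici 2025, (7.1); Connes 2026, Letter, Fact 6.2: `h = (√3/2^{11/4}) h_4 −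
(3/2^{17/4}) h_0` in normalised Hermite functions). [cite: ConnesConsaniMoscovici2025, §7 eq. (7.1)] -/
noncomputable def connesHermiteH (x : ℝ) : ℝ :=
  (π ^ 2 * x ^ 4 - 3 / 2 * π * x ^ 2) * Real.exp (-π * x ^ 2)

/-! ### Mellin transforms of Gaussians -/

/-- `x ↦ x^{v-1} e^{−πx²}` is integrable on `(0, ∞)` for `Re v > 0`. [folklore] -/
theorem mellinConvergent_exp_neg_pi_mul_sq {v : ℂ} (hv : 0 < v.re) :
    MellinConvergent (fun x : ℝ ↦ (Real.exp (-π * x ^ 2) : ℂ)) v := by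
  have hmeas : AEStronglyMeasurable (fun x : ℝ ↦ (Real.exp (-π * x ^ 2) : ℂ))
      (volume.restrict (Ioi 0)) :=
    (Complex.continuous_ofReal.comp (by fun_prop)).aestronglyMeasurable
  rw [MellinConvergent, mellin_convergent_iff_norm Subset.rfl measurableSet_Ioi hmeas]
  have h := integrableOn_rpow_mul_exp_neg_mul_sq Real.pi_pos (s := v.re - 1) (by linarith)
  refine h.congr_fun (fun x _ ↦ ?_) measurableSet_Ioi
  simp only [Complex.norm_real, Real.norm_eq_abs, Real.abs_exp]

/-- **Mellin transform of the Gaussian**: `∫_0^∞ x^{v-1} e^{−πx²} dx = Γ_ℝ(v)/2 = π^{−v/2}Γ(v/2)/2`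
for `Re v > 0` (substitute `u = x²` in Euler's integral). [folklore] -/
theorem mellin_exp_neg_pi_mul_sq {v : ℂ} (hv : 0 < v.re) :
    mellin (fun x : ℝ ↦ (Real.exp (-π * x ^ 2) : ℂ)) v = Complex.Gammaℝ v / 2 := by
  set f : ℝ → ℂ := fun u ↦ Complex.exp (-((π : ℂ) * (u : ℂ))) with hf
  have h1 : mellin (fun x : ℝ ↦ (Real.exp (-π * x ^ 2) : ℂ)) v =
      mellin (fun t : ℝ ↦ f (t ^ (2 : ℝ))) v := by
    refine setIntegral_congr_fun measurableSet_Ioi fun t _ ↦ ?_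
    simp only [hf, Real.rpow_two, Complex.ofReal_exp, Complex.ofReal_mul, Complex.ofReal_neg,
      Complex.ofReal_pow, neg_mul]
  have hv2 : 0 < (v / 2).re := by
    have : (v / 2).re = v.re / 2 := by simp
    rw [this]; linarith
  have h2 : mellin f (v / 2) = (1 / (π : ℂ)) ^ (v / 2) * Complex.Gamma (v / 2) := by
    rw [mellin]
    simp_rw [smul_eq_mul]
    have h := Complex.integral_cpow_mul_exp_neg_mul_Ioi hv2 Real.pi_pos
    simpa only [hf, one_div] using h
  have harg : ((π : ℂ)).arg ≠ Real.pi := by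
    rw [Complex.arg_ofReal_of_nonneg Real.pi_pos.le]; exact Real.pi_pos.ne
  rw [h1, mellin_comp_rpow]
  simp only [Complex.ofReal_ofNat]
  rw [h2, abs_two, Complex.real_smul, Complex.Gammaℝ_def, one_div,
    Complex.inv_cpow _ _ harg, neg_div, Complex.cpow_neg]
  push_cast
  ring

/-- Shifted Gaussians: `x ↦ x^{v-1} · x^n e^{−πx²}` is integrable on `(0,∞)` for `Re v > 0`. [folklore] -/
theorem mellinConvergent_pow_mul_exp_neg_pi_mul_sq (n : ℕ) {v : ℂ} (hv : 0 < v.re) :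
    MellinConvergent (fun x : ℝ ↦ ((x ^ n * Real.exp (-π * x ^ 2) : ℝ) : ℂ)) v := by
  have hfun : (fun x : ℝ ↦ ((x ^ n * Real.exp (-π * x ^ 2) : ℝ) : ℂ)) =
      fun x : ℝ ↦ (x : ℂ) ^ (n : ℂ) • (Real.exp (-π * x ^ 2) : ℂ) := by
    funext x; rw [Complex.cpow_natCast, smul_eq_mul]; push_cast; ring
  have hv' : 0 < (v + n).re := by
    have := Nat.cast_nonneg (α := ℝ) n
    simp only [Complex.add_re, Complex.natCast_re]; linarith
  rw [hfun]
  exact MellinConvergent.cpow_smul.mpr (mellinConvergent_exp_neg_pi_mul_sq hv')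

/-- **Mellin transform of `x^n e^{−πx²}`**: `∫_0^∞ x^{v-1} x^n e^{−πx²} dx = Γ_ℝ(v+n)/2` for `Re v > 0`.
[folklore] -/
theorem mellin_pow_mul_exp_neg_pi_mul_sq (n : ℕ) {v : ℂ} (hv : 0 < v.re) :
    mellin (fun x : ℝ ↦ ((x ^ n * Real.exp (-π * x ^ 2) : ℝ) : ℂ)) v = Complex.Gammaℝ (v + n) / 2 := by
  have hfun : (fun x : ℝ ↦ ((x ^ n * Real.exp (-π * x ^ 2) : ℝ) : ℂ)) =
      fun x : ℝ ↦ (x : ℂ) ^ (n : ℂ) • (Real.exp (-π * x ^ 2) : ℂ) := by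
    funext x; rw [Complex.cpow_natCast, smul_eq_mul]; push_cast; ring
  have hv' : 0 < (v + n).re := by
    have := Nat.cast_nonneg (α := ℝ) n
    simp only [Complex.add_re, Complex.natCast_re]; linarith
  rw [hfun, mellin_cpow_smul, mellin_exp_neg_pi_mul_sq hv']

/-! ### `𝓜h` and `ξ = 4ζ·𝓜h` -/

/-- `h` has an absolutely convergent Mellin transform at every `w` with `Re w > 0`. [folklore] -/
theorem mellinConvergent_connesHermiteH {w : ℂ} (hw : 0 < w.re) :
    MellinConvergent (fun x ↦ (connesHermiteH x : ℂ)) w := by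
  have i4 := mellinConvergent_pow_mul_exp_neg_pi_mul_sq 4 hw
  have i2 := mellinConvergent_pow_mul_exp_neg_pi_mul_sq 2 hw
  rw [MellinConvergent] at i4 i2 ⊢
  have h : IntegrableOn (fun t : ℝ ↦ (π : ℂ) ^ 2 * ((t : ℂ) ^ (w - 1) • ((t ^ 4 * Real.exp (-π * t ^ 2) : ℝ) : ℂ))
      - (3 / 2 : ℂ) * π * ((t : ℂ) ^ (w - 1) • ((t ^ 2 * Real.exp (-π * t ^ 2) : ℝ) : ℂ))) (Ioi 0) :=
    (i4.const_mul ((π : ℂ) ^ 2)).sub (i2.const_mul ((3 / 2 : ℂ) * π))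
  refine h.congr_fun (fun t _ ↦ ?_) measurableSet_Ioi
  simp only [connesHermiteH, smul_eq_mul]
  push_cast
  ring

/-- **`𝓜h(w) = Γ_ℝ(w) · w(w−1)/8`** for `Re w > 0`: by linearity, `𝓜[x^n e^{−πx²}](w) = Γ_ℝ(w+n)/2`
and `Γ_ℝ(s+2) = Γ_ℝ(s)s/(2π)`, `π²·w(w+2)/(8π²) − (3π/2)·w/(4π) = w(w−1)/8`
(Connes–Consani–Moscovici 2025, proof of Lemma 7.1). [cite: ConnesConsaniMoscovici2025, §7 Lemma 7.1] -/
theorem mellin_connesHermiteH {w : ℂ} (hw : 0 < w.re) :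
    mellin (fun x ↦ (connesHermiteH x : ℂ)) w = Complex.Gammaℝ w * (w * (w - 1)) / 8 := by
  have hw0 : w ≠ 0 := by rintro rfl; simp at hw
  have hw2 : w + 2 ≠ 0 := by
    intro h
    have := congrArg Complex.re h
    simp at this
    linarith
  set F4 : ℝ → ℂ := fun x ↦ ((x ^ 4 * Real.exp (-π * x ^ 2) : ℝ) : ℂ) with hF4
  set F2 : ℝ → ℂ := fun x ↦ ((x ^ 2 * Real.exp (-π * x ^ 2) : ℝ) : ℂ) with hF2
  have i4 : MellinConvergent F4 w := mellinConvergent_pow_mul_exp_neg_pi_mul_sq 4 hw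
  have i2 : MellinConvergent F2 w := mellinConvergent_pow_mul_exp_neg_pi_mul_sq 2 hw
  have m4 : mellin F4 w = Complex.Gammaℝ (w + 4) / 2 := by
    have := mellin_pow_mul_exp_neg_pi_mul_sq 4 hw
    simp only [Nat.cast_ofNat] at this
    exact this
  have m2 : mellin F2 w = Complex.Gammaℝ (w + 2) / 2 := by
    have := mellin_pow_mul_exp_neg_pi_mul_sq 2 hw
    simp only [Nat.cast_ofNat] at this
    exact this
  rw [MellinConvergent] at i4 i2
  have hsplit : mellin (fun x ↦ (connesHermiteH x : ℂ)) w =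
      (π : ℂ) ^ 2 * mellin F4 w - (3 / 2 : ℂ) * π * mellin F2 w := by
    simp only [mellin]
    rw [← integral_const_mul, ← integral_const_mul, ← integral_sub (i4.const_mul _) (i2.const_mul _)]
    refine setIntegral_congr_fun measurableSet_Ioi fun t _ ↦ ?_
    simp only [connesHermiteH, hF4, hF2, smul_eq_mul]
    push_cast
    ring
  rw [hsplit, m4, m2, show w + 4 = w + 2 + 2 by ring, Complex.Gammaℝ_add_two hw2,
    Complex.Gammaℝ_add_two hw0]
  field_simp
  ring

/-- **Connes–Consani–Moscovici 2025, Lemma 7.1 / Letter Fact 6.2 (Mellin form): `ξ(w) = 4 ζ(w) 𝓜h(w)`**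
for `Re w > 0`, `w ≠ 1`, with `h(x) = (π²x⁴ − (3/2)πx²)e^{−πx²}`; equivalently (Müntz)
`ξ(½+s) = 4 𝓜[𝓔h](s)`: "the `Ξ` function of Riemann is the Fourier transform of `k = 𝓔(h)`".
Here `ξ` is the tree's `riemannXi` (`= w(w−1)/2 · Λ(w)` for `w ≠ 0, 1`) and `ζ = Λ/Γ_ℝ` (Mathlib).
[cite: ConnesConsaniMoscovici2025, §7 Lemma 7.1] -/
theorem riemannXi_eq_four_mul_zeta_mul_mellin {w : ℂ} (hw : 0 < w.re) (hw1 : w ≠ 1) :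
    riemannXi w = 4 * (riemannZeta w * mellin (fun x ↦ (connesHermiteH x : ℂ)) w) := by
  have hw0 : w ≠ 0 := by rintro rfl; simp at hw
  have hG : Complex.Gammaℝ w ≠ 0 := Complex.Gammaℝ_ne_zero_of_re_pos hw
  rw [mellin_connesHermiteH hw, riemannXi_eq_mul_completedRiemannZeta hw0 hw1,
    riemannZeta_def_of_ne_zero hw0]
  field_simp
  ring

end Literature.NumberTheory.LFunctions
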